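import Summits.ResolutionOfSingularities.ResolutionOfSingularities.Theorems.EquisingularLiftEquisingularLiftNatSpecimenQuarticTcDeltaEngine
import HarnessLib

/-!
# [OURS · L1 W4.5(b) · EL♮(3)] SPECIMEN-Q DOWNSTAIRS, part E (2/2) — the (TC)-STEP ENGINE (clause lemmas + open-chart wrapper) on the charts of a blow-up of a scheme
# `X` at a closed point `x₀` with an affine neighbourhood `U ≅ Spec k[X₀, X₁, X₂]` centred at `x₀`
# (crux `EquisingularLiftNatThree` = stmt-ResolutionOfSingularities-20148, line `sections3`; res-L1-w45b-lead-2 CUT 2026-08-27T08:41:07Z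
# «SPECIMEN-Q DOWNSTAIRS» to res-D-pv-034 AS res-L1-s36-pv-3; helper `--supports … --as helper`, closes nothing)

HONEST FRAMING. OURS (cell `res-hironaka`, chain w45b, slot W4.5(b)); NOT a statement of any manuscript; AI-written, weaker
than expert review. Generic scheme plumbing (DeJong1996's `VertexBlowupCharts` pattern made base-agnostic) feeding the clauses of
the (TC) constructor of the registered stub `stub_elnat_tcDeltaPointResolution` (L/res-L1-w45b-lead-2/TARGET-T-ISO-0PLUS.lean):
«`¬ e ⊆ St(W)`», «`¬ St ⊆ Z`», «`Sing V(Z)_red` finite» for `Z = e ∩ St`.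

SETTING. `b : X' → X` a blow-up (`IsBlowup`) along the ideal sheaf of a CLOSED point `x₀`; `U` an affine open with
`e : Γ(X, U) ≅ k[X₀,X₁,X₂]` carrying `𝓘_{x₀}(U)` onto `(X₀,X₁,X₂)` (`hI`); a closed `T ⊆ X` with `𝓘_T(U) = (e⁻¹ f)` (read through
`fromSpec_mem_iff_of_ideal_eq` as `hT`). CONTENT: `exists_chartE` / `iSup_blowupChart_eq` (open immersions
`Spec k[X][𝔪/Xᵢ] → X'` covering `b⁻¹ U`, `IsBlowup.exists_chart_of_ringEquiv`); on a chart, `chart_apply_eq_iff` (over `x₀` iff the prime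
contains `Xᵢ/1`), `chart_apply_mem_iff`, `preimage_preimage_singleton` (`e = V(Xᵢ/1)`), `preimage_strictTransform_eq` (`St(T) = V(f′ᵢ)`
when `f = (Xᵢ/1)²f′ᵢ` with `f′ᵢ` prime, `f′ᵢ ∤ Xᵢ/1` — density of the generic point `(f′ᵢ)`), and the clause lemmas
`not_preimage_singleton_subset_strictTransform`, `not_strictTransform_subset_inter`, `isRegularLocalRing_inter_of_mem_range_chart`
(`V(Z)_red` regular over a chart where `√(Xᵢ/1, f′ᵢ) = J` with `k[X][𝔪/Xᵢ]/J` regular — generic `isRegularLocalRing_subscheme_of_chart`: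
`V(K.comap c) ≅ V(K) ×_{X'} Spec C → V(K)` open immersion, `V(J~) = Spec (C/J)`); `OpenChart`: the `(U, e)` data from an open-immersion
chart `u : Spec A → X` (`chartOpen`, `chartRingEquiv`, `map_ideal_chartOpen_eq`). The specimen's ring inputs are
`…SpecimenQuarticTcDeltaAmbientCharts` (p519832).

References: The Stacks Project, Tags 0804, 052Q, 080E; Hartshorne II Ex. 3.2.6, Prop. 5.9; Görtz–Wedhorn I (13.19), Prop. 13.91.
-/

set_option linter.dupNamespace false

noncomputable section

open CategoryTheory CategoryTheory.Limits AlgebraicGeometry TopologicalSpace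
open MvPolynomial
open Literature.AlgebraicGeometry.Resolution
open AlgebraicGeometry.Scheme.IdealSheafData
open Summit.ResolutionOfSingularities.ResolutionOfSingularities.Theorems.EquisingularLift

namespace Summit.ResolutionOfSingularities.ResolutionOfSingularities.Cruxes.EquisingularLiftNat.Sections

namespace SpecimenQuarticTcDelta

universe u

section Engine

variable {k : Type} [Field k]
variable {X X' : Scheme.{0}} {b : X' ⟶ X} (U : X.affineOpens) (e : Γ(X, U) ≃+* MvPolynomial (Fin 3) k)
  {x₀ : X} (hx₀ : IsClosed ({x₀} : Set X))

variable (hI : ((vanishingIdeal (⟨{x₀}, hx₀⟩ : Closeds X)).ideal U).map e.toRingHom = PointBlowup.originIdeal 2 k)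

variable {U e}

/-! ## Consequences for the (TC) clauses -/

include hI in
/-- **Cover**: a point of `X'` over `U` lies in the image of one of the three charts. [cite: StacksProject, Tag 0804] -/
theorem exists_mem_range_chart (hb : IsBlowup b (vanishingIdeal (⟨{x₀}, hx₀⟩ : Closeds X)))
    (c : ∀ i : Fin 3, Spec (.of (PointBlowup.Chart 2 k i)) ⟶ X') [∀ i, IsOpenImmersion (c i)]
    (hc : ∀ i, (c i).opensRange = blowupChart b (vanishingIdeal (⟨{x₀}, hx₀⟩ : Closeds X)) U (e.symm (MvPolynomial.X i)))
    {y : X'} (hy : b y ∈ (U : X.Opens)) : ∃ i, y ∈ Set.range (c i) := by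
  have hy' : y ∈ b ⁻¹ᵁ (U : X.Opens) := hy
  rw [← iSup_blowupChart_eq U e hx₀ hI hb, Opens.mem_iSup] at hy'
  obtain ⟨i, hi⟩ := hy'
  refine ⟨i, ?_⟩
  rw [← hc i] at hi
  exact hi

include hI in
/-- **Clause «¬ e ⊆ St»**: if on the `i`-th chart `f = (Xᵢ/1)²·f′ᵢ` with `(Xᵢ/1, f′ᵢ) = (1)` (`f′ᵢ ≡ unit mod Xᵢ/1`), then the point
`(Xᵢ/1)` of that chart lies on the exceptional divisor but off the strict transform of `T`. [OURS · (TC) input] [folklore] -/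
theorem not_preimage_singleton_subset_strictTransform {T : Set X} {f : MvPolynomial (Fin 3) k}
    (hT : ∀ r : Spec Γ(X, U), U.2.fromSpec r ∈ T ↔ e.symm f ∈ r.asIdeal)
    {i : Fin 3} {c : Spec (.of (PointBlowup.Chart 2 k i)) ⟶ X'} [IsOpenImmersion c]
    (hc : c ≫ b = Spec.map (CommRingCat.ofHom (toChartE U e i)) ≫ U.2.fromSpec)
    {f' : PointBlowup.Chart 2 k i}
    (hf : algebraMap (MvPolynomial (Fin 3) k) (PointBlowup.Chart 2 k i) f = PointBlowup.exc 2 k i ^ 2 * f')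
    (htop : Ideal.span {PointBlowup.exc 2 k i, f'} = ⊤) :
    ¬ (b ⁻¹' {x₀} ⊆ closure (b ⁻¹' (T \ {x₀}))) := by
  intro hsub
  have hprime : Prime (PointBlowup.exc 2 k i) := SpecimenQuartic.prime_exc k i
  let q : Spec (CommRingCat.of (PointBlowup.Chart 2 k i)) :=
    ⟨Ideal.span {PointBlowup.exc 2 k i}, (Ideal.span_singleton_prime hprime.ne_zero).mpr hprime⟩
  have hq₁ : c q ∈ b ⁻¹' {x₀} := by
    change q ∈ c ⁻¹' (b ⁻¹' {x₀})
    rw [preimage_preimage_singleton hx₀ hI hc]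
    exact (mem_zeroLocus_singleton_iff q _).mpr (Ideal.mem_span_singleton_self _)
  have hq₂ : q ∈ c ⁻¹' closure (b ⁻¹' (T \ {x₀})) := hsub hq₁
  have hq₃ : f' ∈ q.asIdeal :=
    (mem_zeroLocus_singleton_iff q _).mp (preimage_strictTransform_subset hx₀ hI hT hc hf hq₂)
  have hle : Ideal.span {PointBlowup.exc 2 k i, f'} ≤ q.asIdeal := by
    rw [Ideal.span_le]
    rintro _ (rfl | rfl)
    · exact Ideal.mem_span_singleton_self _
    · exact hq₃
  rw [htop, top_le_iff] at hle
  exact q.isPrime.ne_top hle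

include hI in
/-- **Clause «¬ St ⊆ Z»**: if on some chart `f = (Xᵢ/1)²·f′ᵢ` with `f′ᵢ` prime not dividing `Xᵢ/1`, the generic point `(f′ᵢ)` of the
strict transform on that chart is off the exceptional divisor. [OURS · (TC) input] [folklore] -/
theorem not_strictTransform_subset_inter {T : Set X} {f : MvPolynomial (Fin 3) k}
    (hT : ∀ r : Spec Γ(X, U), U.2.fromSpec r ∈ T ↔ e.symm f ∈ r.asIdeal)
    {i : Fin 3} {c : Spec (.of (PointBlowup.Chart 2 k i)) ⟶ X'} [IsOpenImmersion c]
    (hc : c ≫ b = Spec.map (CommRingCat.ofHom (toChartE U e i)) ≫ U.2.fromSpec)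
    {f' : PointBlowup.Chart 2 k i}
    (hf : algebraMap (MvPolynomial (Fin 3) k) (PointBlowup.Chart 2 k i) f = PointBlowup.exc 2 k i ^ 2 * f')
    (hp : Prime f') (hnd : ¬ f' ∣ PointBlowup.exc 2 k i) :
    ¬ (closure (b ⁻¹' (T \ {x₀})) ⊆ b ⁻¹' {x₀} ∩ closure (b ⁻¹' (T \ {x₀}))) := by
  intro hsub
  let η : Spec (CommRingCat.of (PointBlowup.Chart 2 k i)) :=
    ⟨Ideal.span {f'}, (Ideal.span_singleton_prime hp.ne_zero).mpr hp⟩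
  have hη : η ∈ c ⁻¹' closure (b ⁻¹' (T \ {x₀})) := by
    rw [preimage_strictTransform_eq hx₀ hI hT hc hf hp hnd]
    exact (mem_zeroLocus_singleton_iff η _).mpr (Ideal.mem_span_singleton_self _)
  have hη' : c η ∈ b ⁻¹' {x₀} := (hsub hη).1
  have : η ∈ c ⁻¹' (b ⁻¹' {x₀}) := hη'
  rw [preimage_preimage_singleton hx₀ hI hc] at this
  exact hnd (Ideal.mem_span_singleton.mp ((mem_zeroLocus_singleton_iff η _).mp this))

include hI in
/-- **No point of `Z = e ∩ St` lies on a chart where `(Xᵢ/1, f′ᵢ) = (1)`.** [folklore] -/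
theorem not_mem_inter_of_mem_range_chart_of_top {T : Set X} {f : MvPolynomial (Fin 3) k}
    (hT : ∀ r : Spec Γ(X, U), U.2.fromSpec r ∈ T ↔ e.symm f ∈ r.asIdeal)
    {i : Fin 3} {c : Spec (.of (PointBlowup.Chart 2 k i)) ⟶ X'} [IsOpenImmersion c]
    (hc : c ≫ b = Spec.map (CommRingCat.ofHom (toChartE U e i)) ≫ U.2.fromSpec)
    {f' : PointBlowup.Chart 2 k i}
    (hf : algebraMap (MvPolynomial (Fin 3) k) (PointBlowup.Chart 2 k i) f = PointBlowup.exc 2 k i ^ 2 * f')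
    (htop : Ideal.span {PointBlowup.exc 2 k i, f'} = ⊤) {y : X'} (hy : y ∈ Set.range c) :
    y ∉ b ⁻¹' {x₀} ∩ closure (b ⁻¹' (T \ {x₀})) := by
  rintro ⟨h1, h2⟩
  obtain ⟨q, rfl⟩ := hy
  have hq1 : PointBlowup.exc 2 k i ∈ q.asIdeal := by
    have : q ∈ c ⁻¹' (b ⁻¹' {x₀}) := h1
    rw [preimage_preimage_singleton hx₀ hI hc] at this
    exact (mem_zeroLocus_singleton_iff q _).mp this
  have hq2 : f' ∈ q.asIdeal :=
    (mem_zeroLocus_singleton_iff q _).mp (preimage_strictTransform_subset hx₀ hI hT hc hf h2)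
  have hle : Ideal.span {PointBlowup.exc 2 k i, f'} ≤ q.asIdeal := by
    rw [Ideal.span_le]
    rintro _ (rfl | rfl)
    · exact hq1
    · exact hq2
  rw [htop, top_le_iff] at hle
  exact q.isPrime.ne_top hle

include hI in
/-- **Clause «Sing V(Z)_red finite», chartwise**: if on the `i`-th chart `f = (Xᵢ/1)²·f′ᵢ` with `f′ᵢ` prime not dividing `Xᵢ/1`, and
`√(Xᵢ/1, f′ᵢ) = J` with `k[X][𝔪/Xᵢ]/J` regular, then the reduced structure on `Z = b⁻¹{x₀} ∩ closure(b⁻¹(T ∖ {x₀}))` is regular at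
every point over that chart. [OURS · (TC) input] [cite: Hartshorne1977, II Example 3.2.6] -/
theorem isRegularLocalRing_inter_of_mem_range_chart {T : Set X} {f : MvPolynomial (Fin 3) k}
    (hT : ∀ r : Spec Γ(X, U), U.2.fromSpec r ∈ T ↔ e.symm f ∈ r.asIdeal)
    {i : Fin 3} {c : Spec (.of (PointBlowup.Chart 2 k i)) ⟶ X'} [IsOpenImmersion c]
    (hc : c ≫ b = Spec.map (CommRingCat.ofHom (toChartE U e i)) ≫ U.2.fromSpec)
    {f' : PointBlowup.Chart 2 k i}
    (hf : algebraMap (MvPolynomial (Fin 3) k) (PointBlowup.Chart 2 k i) f = PointBlowup.exc 2 k i ^ 2 * f')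
    (hp : Prime f') (hnd : ¬ f' ∣ PointBlowup.exc 2 k i)
    (J : Ideal (PointBlowup.Chart 2 k i)) (hJ : (Ideal.span {PointBlowup.exc 2 k i, f'}).radical = J)
    [IsRegularRing (PointBlowup.Chart 2 k i ⧸ J)]
    (hZ : IsClosed (b ⁻¹' {x₀} ∩ closure (b ⁻¹' (T \ {x₀}))))
    (z : (vanishingIdeal (⟨b ⁻¹' {x₀} ∩ closure (b ⁻¹' (T \ {x₀})), hZ⟩ : Closeds X')).subscheme)
    (hz : (vanishingIdeal (⟨b ⁻¹' {x₀} ∩ closure (b ⁻¹' (T \ {x₀})), hZ⟩ : Closeds X')).subschemeι z ∈ Set.range c) :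
    IsRegularLocalRing ((vanishingIdeal (⟨b ⁻¹' {x₀} ∩ closure (b ⁻¹' (T \ {x₀})), hZ⟩ : Closeds X')).subscheme.presheaf.stalk z) := by
  refine isRegularLocalRing_subscheme_of_chart _ c J ?_ z hz
  rw [comap_vanishingIdeal_of_isOpenImmersion]
  have hpre : (Closeds.preimage (⟨b ⁻¹' {x₀} ∩ closure (b ⁻¹' (T \ {x₀})), hZ⟩ : Closeds X') c.continuous) =
      ⟨PrimeSpectrum.zeroLocus {PointBlowup.exc 2 k i, f'}, PrimeSpectrum.isClosed_zeroLocus _⟩ := by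
    apply Closeds.ext
    change c ⁻¹' (b ⁻¹' {x₀} ∩ closure (b ⁻¹' (T \ {x₀}))) = PrimeSpectrum.zeroLocus {PointBlowup.exc 2 k i, f'}
    rw [Set.preimage_inter, preimage_preimage_singleton hx₀ hI hc, preimage_strictTransform_eq hx₀ hI hT hc hf hp hnd]
    exact (PrimeSpectrum.zeroLocus_union {PointBlowup.exc 2 k i} {f'}).symm.trans (by rw [Set.singleton_union])
  rw [hpre, vanishingIdeal_zeroLocus_Spec, hJ]

end Engine
/-! ## From an open-immersion chart `u : Spec k[X₀,X₁,X₂] → X` to the `(U, e)` data -/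

section OpenChart

variable {X : Scheme.{0}} {A : CommRingCat.{0}} (u : Spec A ⟶ X) [IsOpenImmersion u]

/-- The image of the chart as an affine open of `X`. [folklore] -/
def chartOpen : X.affineOpens :=
  ⟨u ''ᵁ ⊤, by rw [Scheme.Hom.image_top_eq_opensRange]; exact isAffineOpen_opensRange u⟩

/-- `Γ(X, u(Spec A)) ≅ A`. [folklore] -/
def chartRingEquiv : Γ(X, (chartOpen u : X.Opens)) ≃+* A :=
  ((u.appIso ⊤) ≪≫ Scheme.ΓSpecIso A).commRingCatIsoToRingEquiv

/-- The centre of the chart lies in its image. [folklore] -/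
theorem mem_chartOpen_of_mem_range {x₀ : X} (hx : x₀ ∈ Set.range u) : x₀ ∈ (chartOpen u : X.Opens) := by
  change x₀ ∈ ((u ''ᵁ ⊤ : X.Opens) : Set X)
  rw [Scheme.Hom.image_top_eq_opensRange]
  exact hx

/-- **Ideals of sections on the chart from pull-backs**: if `I` pulls back along `u` to `J~`, then `𝓘(u(Spec A))` corresponds to `J`
under `Γ(X, u(Spec A)) ≅ A`. [folklore] -/
theorem map_ideal_chartOpen_eq (I : X.IdealSheafData) (J : Ideal A)
    (hI : I.comap u = ofIdealTop (J.map (Scheme.ΓSpecIso A).inv.hom)) :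
    (I.ideal (chartOpen u)).map (chartRingEquiv u).toRingHom = J := by
  have h1 := ideal_comap_of_isOpenImmersion I u ⟨⊤, isAffineOpen_top _⟩
  rw [hI, ideal_ofIdealTop_top] at h1
  -- `h1 : J.map ΓSpecIso.inv = (I.ideal (chartOpen u)).comap (u.appIso ⊤).inv`
  have hbij : Function.Bijective (Scheme.ΓSpecIso A).inv.hom :=
    (Scheme.ΓSpecIso A).symm.commRingCatIsoToRingEquiv.bijective
  have h2 : ((I.ideal (chartOpen u)).comap (u.appIso ⊤).inv.hom).comap (Scheme.ΓSpecIso A).inv.hom = J :=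
    (congrArg (Ideal.comap (Scheme.ΓSpecIso A).inv.hom) h1).symm.trans (Ideal.comap_map_of_bijective _ hbij)
  have h3 : (I.ideal (chartOpen u)).comap ((chartRingEquiv u).symm : A →+* Γ(X, (chartOpen u : X.Opens))) = J := by
    refine Eq.trans ?_ h2
    ext a
    exact Iff.rfl
  have h4 := Ideal.comap_symm (I := I.ideal (chartOpen u)) (chartRingEquiv u)
  exact (h4.symm.trans h3 : _)

/-- The same, solved for the ideal of sections: `𝓘(u(Spec A)) = (e⁻¹ g)` when `I` pulls back to `(g)~`. [folklore] -/
theorem ideal_chartOpen_eq_span (I : X.IdealSheafData) (g : A)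
    (hI : I.comap u = ofIdealTop ((Ideal.span {g}).map (Scheme.ΓSpecIso A).inv.hom)) :
    I.ideal (chartOpen u) = Ideal.span {(chartRingEquiv u).symm g} := by
  have h := map_ideal_chartOpen_eq u I (Ideal.span {g}) hI
  have h2 := congrArg (Ideal.map (chartRingEquiv u).symm.toRingHom) h
  rw [Ideal.map_map, Ideal.map_span, Set.image_singleton] at h2
  have hid : (chartRingEquiv u).symm.toRingHom.comp (chartRingEquiv u).toRingHom = RingHom.id _ := by
    ext a; simp
  rw [hid, Ideal.map_id] at h2
  exact h2

end OpenChart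


end SpecimenQuarticTcDelta

end Summit.ResolutionOfSingularities.ResolutionOfSingularities.Cruxes.EquisingularLiftNat.Sections
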